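import Summits.ABC.StewartYu.PadicG3OneSizes
import Summits.ABC.StewartYu.PadicG3OddCeilings
import Summits.ABC.StewartYu.PadicG3OddLogForm
import Summits.ABC.StewartYu.PadicG3VbSizes
import Literature.NumberTheory.Transcendental.PiTranscendenceMeasureMain
import HarnessLib

/-!
# Cell abc-stewartyu, crux `Y07Odd` (stmt-ABC-19658), `m ≥ 1` branch: the k-step GAIN LINES of `IneqPackR₃` at the record schedule
# `P.sched1b b` (PART A, file 3 — the `hgainK0 / hgainO / hgainK` inputs of p5's `ineqPackR₃_of_lines`)

`Summits/ABC/StewartYu/PadicG3OneLines.lean` — cell `abc-stewartyu` (seat p1-g8; route-holder split 2026-08-27T05:41:03Z; shapes = p5-g4's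
`PadicG3OddLines.hK0_of_lines / hO_of_lines / hK_of_lines`, STATUS 06:25:21Z).  Theorems only, no named fact.

THE COMPARISON (unit `Z = G·X·L`; heights `h(αⱼ) ≤ Aⱼ`, `Aⱼ ≥ 1`, `log max(3,|bⱼ|) ≤ W`, `θ₀ = ½`, box scale `b ≥ 1`).  COST of a k-step at
level `lev`, stage `ν` (`ν + 1 ≤ n`), node `|x₁| ≤ NS lev (ν+1)`, multi-order `τ` with `τ.1 + |τ.2| + tS lev ≤ TordS lev ν`:
`log BwP + log KC ≤ (5/2)·Z + 2^ν·Z/2` (`costK_1b_le`), slot by slot through p5's ceilings (`log_KC_le`, `log_PmaxS₂_le`, `log_AmaxS₂_eq`,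
`log_UcardS₂_eq`, `log_M0C_le'`): `log BwP ≤ L₀(G+1) ≤ Z/4 + G + 1`; `log UcardS₂ ≤ lunk ≤ Z/32 + 1` (twice); the START size
`log AmaxS₂ ≤ 1.356·Z + …` (`T₀·(Ŝ log 2 + (23/20)H) ≤ (83/320 + 1909/6400)·Z` with the sharp `ψ(H) ≤ (23/20)H` of `NWPi.log_lcmUpto_le`,
`T₀·log XbSS₂ ≤ (1909/6400)·Z`, `Y₀`-line `Z/4 + yload`, START far height `Z/4`); the step's `M0C`/`XbC` slots at the SHARED budget
`τ.1 + |τ.2| ≤ (83/5)(n+1)L` charged at the `τ.1`-rate (`log max(1,XbC) ≤ (23/20)H`): `≤ (83/320 + 1909/6400)·Z + Z/4 + …`; far height `2^ν·Z/2`;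
negligible terms `2·yload + G + 2H + 8 ≤ Z/500`.  GAIN: `g·(m+½)·log p = zeros ≥ (31/4)·2^ν·Z` (`zeros_ge`).  Hence
**`hgainK0_sched1b`**, **`hgainO_sched1b`**, **`hgainK_sched1b`** — literally the `hgain*` hypotheses of `hK0_of_lines` / `hO_of_lines` /
`hK_of_lines` at `Sc := P.sched1b b`.

WHAT THIS IS NOT: the half-step gain line (p4 g4 `PadicG3HalfLines`), the exponent / Λ-lines (p5 `PadicG3OneExpLines`, lp-1 `PadicG3OddLamLines`),
(B1) (lp-1), or the assembly (p5); no crux moves.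

References: Yu. V. Nesterenko, LNM 1819 (2003) §4.2 (4.24)–(4.35); K. Yu, Acta Math. 211 (2013) Lemma 5.2; HOME/p1/K-M3-1-padic-ledger.md §4 (B3).
-/

noncomputable section

open Finset Real
open Literature.NumberTheory.Transcendental
open Literature.NumberTheory.Transcendental.PadicCW77 (condExp)
open Literature.NumberTheory.Transcendental.CW77.Setup (Tau tauNorm)

namespace Summit.ABC.StewartYu

namespace PadicG3Par

variable {n : ℕ} (P : PadicG3Par n)

/-- `⌊L₀/(p−1)⌋·log p ≤ L₀` (`log p ≤ p − 1`). [folklore] -/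
theorem floor_div_mul_log_le₁ : ((P.L₀ / (P.p - 1) : ℕ) : ℝ) * Real.log P.p ≤ P.L₀ := by
  have hp : (2 : ℝ) ≤ P.p := P.two_le_p
  have hlog : Real.log (P.p : ℝ) ≤ (P.p : ℝ) - 1 := Real.log_le_sub_one_of_pos (by linarith)
  have hlog0 := P.log_p_pos
  have h1 : ((P.L₀ / (P.p - 1) : ℕ) : ℝ) * ((P.p : ℝ) - 1) ≤ P.L₀ := by
    have h := Nat.div_mul_le_self P.L₀ (P.p - 1)
    have h' : (((P.L₀ / (P.p - 1)) * (P.p - 1) : ℕ) : ℝ) ≤ P.L₀ := by exact_mod_cast h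
    have hp1 : 1 ≤ P.p := le_trans (by norm_num) P.hp
    push_cast [Nat.cast_sub hp1] at h'
    exact h'
  have h0 : (0 : ℝ) ≤ ((P.L₀ / (P.p - 1) : ℕ) : ℝ) := by positivity
  nlinarith

/-- **`(31/4)·2^ν·Z ≤ ((2·2^ν·Xs s + 1)·(T s + 1))·G`** (the k-step zeros·gain). [cite: Nesterenko2003, (4.25)] -/
theorem gainK_ge (s ν : ℕ) :
    (31 / 4 : ℝ) * 2 ^ ν * (P.G * P.X * P.L) ≤ (((2 * (2 ^ ν * P.Xs s) + 1) * (P.T s + 1) : ℕ) : ℝ) * P.G := by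
  have hz := P.zeros_ge s ν
  unfold zeros at hz
  have hG : 0 ≤ P.G := by linarith [P.eight_le_G]
  have hT : (0 : ℝ) ≤ (P.T s : ℝ) + 1 := by positivity
  push_cast
  have e : P.G * (2 ^ (ν + 1) * (P.Xs s : ℝ)) * (P.T s + 1) = (2 * (2 ^ ν * (P.Xs s : ℝ))) * (P.T s + 1) * P.G := by
    rw [pow_succ]; ring
  rw [e] at hz
  nlinarith

/-- **`(31/4)·Z ≤ ((2·Xs s)·(T s + 1))·G`** (the odd-node zeros·gain). [cite: Nesterenko2003, (4.25)] -/
theorem gainO_ge (s : ℕ) : (31 / 4 : ℝ) * (P.G * P.X * P.L) ≤ (((2 * P.Xs s) * (P.T s + 1) : ℕ) : ℝ) * P.G := by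
  have hz := P.zeros_ge s 0
  unfold zeros at hz
  push_cast
  simp only [pow_zero, mul_one, zero_add, pow_one] at hz
  linarith

end PadicG3Par

namespace G3Setup

variable {p : ℕ} [Fact p.Prime] (S : G3Setup p) (P : PadicG3Par S.n) (b : ℝ)

/-! ### The slots at `P.sched1b b` -/

/-- `log UcardS₂ (sched1b b) ≤ lunk` (`2·sideⱼ + 1 ≤ L/Aⱼ + 1 ≤ 2L`). [folklore] -/
theorem log_UcardS₂_1b_le (hb : 1 ≤ b) (hA1 : ∀ j, 1 ≤ P.A j) : Real.log (S.UcardS₂ (P.sched1b b) : ℝ) ≤ P.lunk := by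
  rw [S.log_UcardS₂_eq]
  unfold PadicG3Par.lunk
  rw [P.sched1b_L₀]
  have hL1 : (1 : ℝ) ≤ P.L := P.one_le_L
  have hb0 : 0 < b := lt_of_lt_of_le zero_lt_one hb
  have hLbox : 0 ≤ (P.sched1b b).Lbox := by rw [P.sched1b_Lbox]; positivity
  have hside : ∀ j, 2 * (S.sideS₂ (P.sched1b b) j : ℝ) + 1 ≤ 2 * P.L := by
    intro j
    have h := S.two_sideS₂_add_one_le (P.sched1b b) hLbox j
    rw [P.sched1b_Lbox, P.sched1b_A] at h
    have hA := hA1 j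
    have h1 : (P.L : ℝ) / b / P.A j ≤ P.L := by
      rw [div_div, div_le_iff₀ (by positivity)]
      have : (1 : ℝ) ≤ b * P.A j := by nlinarith
      nlinarith
    linarith
  have hpos : ∀ j, (0 : ℝ) < 2 * (S.sideS₂ (P.sched1b b) j : ℝ) + 1 := fun j => by positivity
  have hsum : ∑ j, Real.log (2 * (S.sideS₂ (P.sched1b b) j : ℝ) + 1) ≤ ∑ _j : Fin S.n, Real.log (2 * (P.L : ℝ)) :=
    Finset.sum_le_sum fun j _ => Real.log_le_log (hpos j) (hside j)
  rw [Finset.sum_const, Finset.card_univ, Fintype.card_fin, nsmul_eq_mul] at hsum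
  linarith

/-- `log BwP(L₀, m) ≤ Z/4 + G + 1` at `θ₀ = ½` (`⌊L₀/(p−1)⌋ log p ≤ L₀`, `(m+½) log p = G`, `L₀(G+1) ≤ Z/4 + G + 1`). [folklore] -/
theorem log_BwP_1b_le (hPp : P.p = p) (hθ : P.θ₀ = 1 / 2) :
    Real.log (BwP (p := p) P.L₀ P.m) ≤ P.G * P.X * P.L / 4 + P.G + 1 := by
  rw [G3OddLog.log_BwP]
  have h1 := P.floor_div_mul_log_le₁
  have h2 := P.half_log_eq_G hθ
  have h3 := P.L0_mul_G_add_one_le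
  rw [hPp] at h1 h2
  rw [h2]
  nlinarith

/-- **The START size**: `log AmaxS₂ (sched1b b) ≤ (34/25)·Z + yload + H + 1`. [cite: Nesterenko2003, Prop 3.9 (3.40); shape only] -/
theorem log_AmaxS₂_1b_le (hb : 1 ≤ b) (hWb : ∀ j, Real.log (max 3 (|S.b j| : ℝ)) ≤ P.W)
    (hV : ∀ j, Height.logHeight₁ (S.α j) ≤ P.A j) (hA1 : ∀ j, 1 ≤ P.A j) :
    Real.log (S.AmaxS₂ (P.sched1b b)) ≤ (34 / 25) * (P.G * P.X * P.L) + P.yload + P.H + 1 := by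
  rw [S.log_AmaxS₂_eq, S.XbSS₂_cast]
  simp only [P.sched1b_L₀, P.sched1b_H, P.sched1b_Sd]
  -- the three slots
  have hM := log_M0C_le' P.L₀ P.H P.Sdepth 0 (S.NS (P.sched1b b) 0 0 : ℤ) (S.TordS (P.sched1b b) 0 0)
  have hL0 := S.L0_line_start_1b_le P b
  have hXb := S.log_XbC_1b_le_H P b hWb hA1 hb 0
  have hmon := S.two_log_monDen_start_1b_le P b hV hb
  -- the order `T₀ ≤ (83/5)(n+1)L` and its two rates
  have hT0 := S.TordS_1b_zero_real_le P b
  have hT00 : (0 : ℝ) ≤ (S.TordS (P.sched1b b) 0 0 : ℝ) := by positivity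
  have hν := NWPi.log_lcmUpto_le P.H
  have hSd := P.Sdepth_log_two_le_WL
  have hWL := P.WL_mul_le
  have hLH := P.succ_mul_L_mul_H_le_Z
  have hH0 : (0 : ℝ) ≤ P.H := by positivity
  have hWL0 : (0 : ℝ) ≤ P.WL := by linarith [P.WL_ge_one]
  have hlog2 : (0 : ℝ) ≤ Real.log 2 := Real.log_nonneg (by norm_num)
  have hlog27 : Real.log 2 ≤ 7 / 10 := by have := Real.log_two_lt_d9; linarith
  have he : (P.H : ℝ) / Real.exp 1 ≤ P.H := div_le_self hH0 (by have := Real.add_one_le_exp (1:ℝ); linarith)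
  -- cast of the ℕ product `(Ŝ − 0)·T₀`
  have hcast : (((P.Sdepth - 0) * S.TordS (P.sched1b b) 0 0 : ℕ) : ℝ) * Real.log 2 =
      (S.TordS (P.sched1b b) 0 0 : ℝ) * ((P.Sdepth : ℝ) * Real.log 2) := by
    rw [Nat.sub_zero]; push_cast; ring
  rw [hcast] at hM
  -- rates: `T₀·(Ŝ log 2) ≤ T₀·WL`, `T₀·log ν(H) ≤ T₀·(23/20)H`, `T₀·log Xb ≤ T₀·(23/20)H`
  have r1 : (S.TordS (P.sched1b b) 0 0 : ℝ) * ((P.Sdepth : ℝ) * Real.log 2) ≤ (83 / 5) * (S.n + 1) * P.L * P.WL := by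
    calc (S.TordS (P.sched1b b) 0 0 : ℝ) * ((P.Sdepth : ℝ) * Real.log 2) ≤ (S.TordS (P.sched1b b) 0 0 : ℝ) * P.WL :=
          mul_le_mul_of_nonneg_left hSd hT00
      _ ≤ (83 / 5) * (S.n + 1) * P.L * P.WL := mul_le_mul_of_nonneg_right hT0 hWL0
  have r2 : (S.TordS (P.sched1b b) 0 0 : ℝ) * Real.log (Nat.lcmUpto P.H : ℝ) ≤ (83 / 5) * (S.n + 1) * P.L * ((23 / 20) * P.H) := by
    calc (S.TordS (P.sched1b b) 0 0 : ℝ) * Real.log (Nat.lcmUpto P.H : ℝ) ≤ (S.TordS (P.sched1b b) 0 0 : ℝ) * ((23 / 20) * P.H) :=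
          mul_le_mul_of_nonneg_left hν hT00
      _ ≤ (83 / 5) * (S.n + 1) * P.L * ((23 / 20) * P.H) := mul_le_mul_of_nonneg_right hT0 (by positivity)
  have r3 : (S.TordS (P.sched1b b) 0 0 : ℝ) * Real.log (max 1 (S.XbC (S.Lb (S.sideS₂ (P.sched1b b)) 0) : ℝ)) ≤
      (83 / 5) * (S.n + 1) * P.L * ((23 / 20) * P.H) := by
    calc (S.TordS (P.sched1b b) 0 0 : ℝ) * Real.log (max 1 (S.XbC (S.Lb (S.sideS₂ (P.sched1b b)) 0) : ℝ)) ≤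
        (S.TordS (P.sched1b b) 0 0 : ℝ) * ((23 / 20) * P.H) := mul_le_mul_of_nonneg_left hXb hT00
      _ ≤ (83 / 5) * (S.n + 1) * P.L * ((23 / 20) * P.H) := mul_le_mul_of_nonneg_right hT0 (by positivity)
  have e1 : (83 / 5 : ℝ) * (S.n + 1) * P.L * P.WL = (83 / 5) * ((S.n + 1) * P.L * P.WL) := by ring
  have e2 : (83 / 5 : ℝ) * (S.n + 1) * P.L * ((23 / 20) * P.H) = (1909 / 100) * ((S.n + 1) * P.L * P.H) := by ring
  rw [e1] at r1; rw [e2] at r2 r3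
  have hZ := P.GXL_ge
  linarith only [hM, hL0, hmon, r1, r2, r3, hWL, hLH, he, hlog27, hZ]

/-- The multi-order slots of a k-step at the SHARED budget `τ.1 + |τ.2| ≤ TordS lev ν ≤ (83/5)(n+1)L`, charged at the `τ.1`-rate:
`(Ŝ−lev)τ.1·log 2 + τ.1·log ν(H) + |τ.2|·log max(1,XbC) ≤ (83/5)·(n+1)L·W_L + (1909/100)·(n+1)L·H`. [cite: Nesterenko2003, §4.2 (4.31); shape only] -/
theorem tauSlots_1b_le (hb : 1 ≤ b) (hWb : ∀ j, Real.log (max 3 (|S.b j| : ℝ)) ≤ P.W) (hA1 : ∀ j, 1 ≤ P.A j)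
    {lev ν : ℕ} {τ : Tau S.n} (hτ : tauNorm τ + S.tS (P.sched1b b) lev ≤ S.TordS (P.sched1b b) lev ν) :
    (((P.Sdepth - lev) * τ.1 : ℕ) : ℝ) * Real.log 2 + (τ.1 : ℝ) * Real.log (Nat.lcmUpto P.H : ℝ) +
      ((∑ k, τ.2 k : ℕ) : ℝ) * Real.log (max 1 (S.XbC (S.Lb (S.sideS₂ (P.sched1b b)) lev) : ℝ)) ≤
      (83 / 5) * (((S.n : ℝ) + 1) * P.L * P.WL) + (1909 / 100) * (((S.n : ℝ) + 1) * P.L * P.H) := by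
  have hT := S.TordS_1b_real_le P b lev ν
  have hτ' : (τ.1 : ℝ) + ((∑ k, τ.2 k : ℕ) : ℝ) ≤ (S.TordS (P.sched1b b) lev ν : ℝ) := by
    have h1 : tauNorm τ ≤ S.TordS (P.sched1b b) lev ν := le_trans (Nat.le_add_right _ _) hτ
    unfold tauNorm at h1
    exact_mod_cast h1
  have hXb := S.log_XbC_1b_le_H P b hWb hA1 hb lev
  have hν' := NWPi.log_lcmUpto_le P.H
  have hSd := P.Sdepth_log_two_le_WL
  have hH0 : (0 : ℝ) ≤ P.H := Nat.cast_nonneg _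
  have hWL0 : (0 : ℝ) ≤ P.WL := by linarith [P.WL_ge_one]
  have hlog2 : (0 : ℝ) ≤ Real.log 2 := Real.log_nonneg (by norm_num)
  have hτ1 : (0 : ℝ) ≤ (τ.1 : ℝ) := Nat.cast_nonneg _
  have hτ2 : (0 : ℝ) ≤ ((∑ k, τ.2 k : ℕ) : ℝ) := Nat.cast_nonneg _
  -- cast of the ℕ product `(Ŝ − lev)·τ.1`
  have hcast : (((P.Sdepth - lev) * τ.1 : ℕ) : ℝ) * Real.log 2 ≤ (τ.1 : ℝ) * ((P.Sdepth : ℝ) * Real.log 2) := by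
    have h1 : (((P.Sdepth - lev) * τ.1 : ℕ) : ℝ) ≤ (P.Sdepth : ℝ) * τ.1 := by
      have : (P.Sdepth - lev) * τ.1 ≤ P.Sdepth * τ.1 := Nat.mul_le_mul_right _ (Nat.sub_le _ _)
      exact_mod_cast this
    have := mul_le_mul_of_nonneg_right h1 hlog2
    linarith only [this]
  have a1 : (τ.1 : ℝ) * ((P.Sdepth : ℝ) * Real.log 2) ≤ (τ.1 : ℝ) * P.WL := mul_le_mul_of_nonneg_left hSd hτ1
  have a2 : (τ.1 : ℝ) * Real.log (Nat.lcmUpto P.H : ℝ) ≤ (τ.1 : ℝ) * ((23 / 20) * P.H) := mul_le_mul_of_nonneg_left hν' hτ1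
  have a3 : ((∑ k, τ.2 k : ℕ) : ℝ) * Real.log (max 1 (S.XbC (S.Lb (S.sideS₂ (P.sched1b b)) lev) : ℝ)) ≤
      ((∑ k, τ.2 k : ℕ) : ℝ) * ((23 / 20) * P.H) := mul_le_mul_of_nonneg_left hXb hτ2
  have hc0 : (0 : ℝ) ≤ P.WL + (23 / 20) * P.H := by linarith only [hWL0, hH0]
  have a4 : ((τ.1 : ℝ) + ((∑ k, τ.2 k : ℕ) : ℝ)) * (P.WL + (23 / 20) * P.H) ≤
      (S.TordS (P.sched1b b) lev ν : ℝ) * (P.WL + (23 / 20) * P.H) := mul_le_mul_of_nonneg_right hτ' hc0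
  have a5 : (0 : ℝ) ≤ ((∑ k, τ.2 k : ℕ) : ℝ) * P.WL := mul_nonneg hτ2 hWL0
  have r2 : (S.TordS (P.sched1b b) lev ν : ℝ) * (P.WL + (23 / 20) * P.H) ≤
      (83 / 5) * (((S.n : ℝ) + 1) * P.L * P.WL) + (1909 / 100) * (((S.n : ℝ) + 1) * P.L * P.H) := by
    have := mul_le_mul_of_nonneg_right hT hc0
    linarith only [this]
  linarith only [hcast, a1, a2, a3, a4, a5, r2]

/-- **THE k-STEP COST** at `Sc := P.sched1b b`: `log BwP + log KC ≤ (5/2)·Z + 2^ν·Z/2` at level `lev ≤ Ŝ`, stage `ν` (`ν + 1 ≤ n`),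
node `|x₁| ≤ NS lev (ν+1)`, multi-order `τ` with `τ.1 + |τ.2| + tS lev ≤ TordS lev ν`. [cite: Nesterenko2003, §4.2 (4.29)–(4.35); shape only] -/
theorem costK_1b_le (hPp : P.p = p) (hb : 1 ≤ b) (hθ : P.θ₀ = 1 / 2) (hWb : ∀ j, Real.log (max 3 (|S.b j| : ℝ)) ≤ P.W)
    (hV : ∀ j, Height.logHeight₁ (S.α j) ≤ P.A j) (hA1 : ∀ j, 1 ≤ P.A j)
    {lev ν : ℕ} (hlev : lev ≤ P.Sdepth) (hν : ν + 1 ≤ S.n) {x₁ : ℤ} (hx : |x₁| ≤ (S.NS (P.sched1b b) lev (ν + 1) : ℤ))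
    {τ : Tau S.n} (hτ : tauNorm τ + S.tS (P.sched1b b) lev ≤ S.TordS (P.sched1b b) lev ν) :
    Real.log (BwP (p := p) P.L₀ P.m) +
      Real.log (S.KC (S.UcardS₂ (P.sched1b b)) (S.PmaxS₂ (P.sched1b b)) P.L₀ P.H P.Sdepth lev (S.Lb (S.sideS₂ (P.sched1b b)) lev) x₁ τ) ≤
      (5 / 2) * (P.G * P.X * P.L) + 2 ^ ν * (P.G * P.X * P.L / 2) := by
  have hU1 : 1 ≤ S.UcardS₂ (P.sched1b b) := S.one_le_UcardS₂ (P.sched1b b)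
  have hP1 : (1 : ℤ) ≤ S.PmaxS₂ (P.sched1b b) := S.one_le_PmaxS₂ (P.sched1b b)
  have hKC := S.log_KC_le hU1 hP1 P.L₀ P.H P.Sdepth lev (S.Lb (S.sideS₂ (P.sched1b b)) lev) x₁ τ
  have hBw := S.log_BwP_1b_le P hPp hθ
  have hU := S.log_UcardS₂_1b_le P b hb hA1
  have hlunk := P.lunk_le
  have hPm := S.log_PmaxS₂_le (P.sched1b b)
  have hAm := S.log_AmaxS₂_1b_le P b hb hWb hV hA1
  have hM := log_M0C_le' P.L₀ P.H P.Sdepth lev x₁ τ.1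
  have hL0 := S.L0_line_K_1b_le P b hlev hν hx
  have hmon := S.two_log_monDen_box_1b_le P b hV hb lev ν hx
  have hsm := P.small_le
  have hτs := S.tauSlots_1b_le P b hb hWb hA1 hτ
  have hWL := P.WL_mul_le
  have hLH := P.succ_mul_L_mul_H_le_Z
  have hH0 : (0 : ℝ) ≤ P.H := Nat.cast_nonneg _
  have hlog27 : Real.log 2 ≤ 7 / 10 := by have := Real.log_two_lt_d9; linarith
  have he : (P.H : ℝ) / Real.exp 1 ≤ P.H := div_le_self hH0 (by have := Real.add_one_le_exp (1:ℝ); linarith)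
  have hZ := P.GXL_ge
  -- partial sums (keeps the final `linarith` small)
  have s1 : Real.log (M0C P.L₀ P.H P.Sdepth lev x₁ τ.1 : ℝ) +
      ((∑ k, τ.2 k : ℕ) : ℝ) * Real.log (max 1 (S.XbC (S.Lb (S.sideS₂ (P.sched1b b)) lev) : ℝ)) ≤
      (3569 / 6400) * (P.G * P.X * P.L) + P.G * P.X * P.L / 4 + P.yload + P.H + 7 / 10 := by
    linarith only [hM, hτs, hWL, hLH, hL0, he, hlog27]
  have s2 : Real.log (S.PmaxS₂ (P.sched1b b) : ℝ) ≤ 7 / 10 + (P.G * P.X * P.L / 32 + 1) +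
      ((34 / 25) * (P.G * P.X * P.L) + P.yload + P.H + 1) := by
    linarith only [hPm, hU, hlunk, hAm, hlog27]
  linarith only [hKC, hBw, hU, hlunk, s1, s2, hmon, hsm, hZ, hlog27, hH0]

/-! ### The three gain lines (p5's `hgainK0`, `hgainO`, `hgainK` at `Sc := P.sched1b b`) -/

/-- **`hgainK0` at `P.sched1b b`**: the level-`0` k-steps. [cite: Nesterenko2003, §4.2 (4.29)–(4.35); shape only] -/
theorem hgainK0_sched1b (hPp : P.p = p) (hb : 1 ≤ b) (hθ : P.θ₀ = 1 / 2) (hWb : ∀ j, Real.log (max 3 (|S.b j| : ℝ)) ≤ P.W)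
    (hV : ∀ j, Height.logHeight₁ (S.α j) ≤ P.A j) (hA1 : ∀ j, 1 ≤ P.A j) :
    ∀ ν < S.n, ∀ x₁ : ℤ, |x₁| ≤ (S.NS (P.sched1b b) 0 (ν + 1) : ℤ) → ∀ τ : Tau S.n,
      tauNorm τ + S.tS (P.sched1b b) 0 ≤ S.TordS (P.sched1b b) 0 ν →
      Real.log (BwP (p := p) (P.sched1b b).L₀ (P.sched1b b).m) +
        Real.log (S.KC (S.UcardS₂ (P.sched1b b)) (S.PmaxS₂ (P.sched1b b)) (P.sched1b b).L₀ (P.sched1b b).H (P.sched1b b).Sd 0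
          (S.Lb (S.sideS₂ (P.sched1b b)) 0) x₁ τ) <
        (((2 * S.NS (P.sched1b b) 0 ν + 1) * S.tS (P.sched1b b) 0 : ℕ) : ℝ) * ((((P.sched1b b).m : ℝ) + 1 / 2) * Real.log p) := by
  intro ν hν x₁ hx τ hτ
  simp only [P.sched1b_L₀, P.sched1b_m, P.sched1b_H, P.sched1b_Sd]
  have hc := S.costK_1b_le P b hPp hb hθ hWb hV hA1 (Nat.zero_le _) (by omega) hx hτ
  have hg := P.gainK_ge 0 ν
  have hG := P.half_log_eq_G hθ
  rw [hPp] at hG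
  rw [S.NS_1b, S.tS_1b, hG]
  have hZ := P.GXL_ge
  have h2 : (1 : ℝ) ≤ 2 ^ ν := one_le_pow₀ (by norm_num)
  have h3 : P.G * P.X * P.L ≤ 2 ^ ν * (P.G * P.X * P.L) := le_mul_of_one_le_left (by linarith) h2
  linarith

/-- **`hgainO` at `P.sched1b b`**: the odd-node first k-step of each level `≥ 1`. [cite: Nesterenko2003, §4.2 (4.29)–(4.35); shape only] -/
theorem hgainO_sched1b (hPp : P.p = p) (hb : 1 ≤ b) (hθ : P.θ₀ = 1 / 2) (hWb : ∀ j, Real.log (max 3 (|S.b j| : ℝ)) ≤ P.W)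
    (hV : ∀ j, Height.logHeight₁ (S.α j) ≤ P.A j) (hA1 : ∀ j, 1 ≤ P.A j) :
    ∀ lev < (P.sched1b b).Sd, ∀ x₁ : ℤ, |x₁| ≤ (S.NS (P.sched1b b) (lev + 1) 1 : ℤ) → ∀ τ : Tau S.n,
      tauNorm τ + S.tS (P.sched1b b) (lev + 1) ≤ S.TordS (P.sched1b b) (lev + 1) 0 →
      Real.log (BwP (p := p) (P.sched1b b).L₀ (P.sched1b b).m) +
        Real.log (S.KC (S.UcardS₂ (P.sched1b b)) (S.PmaxS₂ (P.sched1b b)) (P.sched1b b).L₀ (P.sched1b b).H (P.sched1b b).Sd (lev + 1)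
          (S.Lb (S.sideS₂ (P.sched1b b)) (lev + 1)) x₁ τ) <
        (((2 * S.NhS (P.sched1b b) (lev + 1)) * S.tS (P.sched1b b) (lev + 1) : ℕ) : ℝ) * ((((P.sched1b b).m : ℝ) + 1 / 2) * Real.log p) := by
  intro lev hlev x₁ hx τ hτ
  simp only [P.sched1b_L₀, P.sched1b_m, P.sched1b_H, P.sched1b_Sd] at hlev ⊢
  have hc := S.costK_1b_le P b hPp hb hθ hWb hV hA1 (show lev + 1 ≤ P.Sdepth by omega) (show 0 + 1 ≤ S.n from P.hn) hx hτ
  have hg := P.gainO_ge (lev + 1)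
  have hG := P.half_log_eq_G hθ
  rw [hPp] at hG
  rw [S.NhS_1b, S.tS_1b, hG]
  have hZ := P.GXL_ge
  simp only [pow_zero, one_mul] at hc
  linarith

/-- **`hgainK` at `P.sched1b b`**: the symmetric k-steps of the levels `≥ 1`. [cite: Nesterenko2003, §4.2 (4.29)–(4.35); shape only] -/
theorem hgainK_sched1b (hPp : P.p = p) (hb : 1 ≤ b) (hθ : P.θ₀ = 1 / 2) (hWb : ∀ j, Real.log (max 3 (|S.b j| : ℝ)) ≤ P.W)
    (hV : ∀ j, Height.logHeight₁ (S.α j) ≤ P.A j) (hA1 : ∀ j, 1 ≤ P.A j) :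
    ∀ lev < (P.sched1b b).Sd, ∀ ν, 1 ≤ ν → ν < S.n → ∀ x₁ : ℤ, |x₁| ≤ (S.NS (P.sched1b b) (lev + 1) (ν + 1) : ℤ) →
      ∀ τ : Tau S.n, tauNorm τ + S.tS (P.sched1b b) (lev + 1) ≤ S.TordS (P.sched1b b) (lev + 1) ν →
      Real.log (BwP (p := p) (P.sched1b b).L₀ (P.sched1b b).m) +
        Real.log (S.KC (S.UcardS₂ (P.sched1b b)) (S.PmaxS₂ (P.sched1b b)) (P.sched1b b).L₀ (P.sched1b b).H (P.sched1b b).Sd (lev + 1)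
          (S.Lb (S.sideS₂ (P.sched1b b)) (lev + 1)) x₁ τ) <
        (((2 * S.NS (P.sched1b b) (lev + 1) ν + 1) * S.tS (P.sched1b b) (lev + 1) : ℕ) : ℝ) * ((((P.sched1b b).m : ℝ) + 1 / 2) * Real.log p) := by
  intro lev hlev ν hν1 hνn x₁ hx τ hτ
  simp only [P.sched1b_L₀, P.sched1b_m, P.sched1b_H, P.sched1b_Sd] at hlev ⊢
  have hc := S.costK_1b_le P b hPp hb hθ hWb hV hA1 (show lev + 1 ≤ P.Sdepth by omega) (by omega) hx hτ
  have hg := P.gainK_ge (lev + 1) ν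
  have hG := P.half_log_eq_G hθ
  rw [hPp] at hG
  rw [S.NS_1b, S.tS_1b, hG]
  have hZ := P.GXL_ge
  have h2 : (1 : ℝ) ≤ 2 ^ ν := one_le_pow₀ (by norm_num)
  have h3 : P.G * P.X * P.L ≤ 2 ^ ν * (P.G * P.X * P.L) := le_mul_of_one_le_left (by linarith) h2
  linarith

end G3Setup

end Summit.ABC.StewartYu

end
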